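import Summits.QuantumFields.YangMills.Theorems.BalabanUVNodesK1RunRowsBoxCongr
import Literature.MathematicalPhysics.QuantumFieldTheory.Balaban1983to89.Node00.Record13Ax

/-!
# BalabanUVNodes ∕ N24 — K1ᴬ ENGINE LANE (dag-lead g40 HANDS op 5b): THE Ax TWINS OF THE Z3 WINDOW-TRANSFER LETTERS AND OF NODE O's RUN-ROWS TRANSFER
# (`betaOfRecord₁₃ ↦ betaOfRecord₁₃Ax`, director-ym №467 (D) σ), FIRST PIECE OF THE Ax-KEYED ENGINE RE-ISSUE

Seat `pub-ymgap-dag-n24-c` (g22); Summits helper lane (`--supports stmt-QuantumFields-27239 --as helper`); theorems only — 0 `def`, 0 `sorry`, 0 `instance`, 0 `notation`.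
Imports ONLY `…K1RunRowsBoxCongr` (✓p782215, the non-Ax transfer + the generic §1 `runRows_of_eqOn_box`) and `Node00/Record13Ax` (the RE-CENTRED β of record `betaOfRecord₁₃Ax`).

WHY.  The K1 engine of record (`…N24K1R9ByNameOfCofinalBetaSocketV23…ZBY` ✓p782234) re-letters NODE O's β-box and run rows from the doors' half-window Z3 member
`theta13OfThm1CCMWZB F 2 j ½ a₀ …` to the engine's window-edition member `theta13OfThm1CCMWZB F 2 j γ a₀ …` (`0 < γ ≤ ½`) by node00's `betaOfRecord₁₃_theta13OfThm1CCMWZB_eq_of_mem` and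
`betaLowerH∕UpperH_theta13OfThm1CCMWZB_of_half` (`Node00/Record13LettersOfThm1CCMWZB`) and by `K1RunRowsBoxCongr.runRows_theta13OfThm1CCMWZB_window_of_half`.  The K1ᴬ item
(stmt-QuantumFields-27239, route rev 31∕33) reads the RE-CENTRED β `Node00.betaOfRecord₁₃Ax` instead (Node00/Record13Ax: `betaOfRecord₁₃Ax θ := betaOfRecord₈Tχ F N (TβOfRecord₁₃ F N)
(chiβOfRecord₁₃Ax F N θ) θ.toStage8Params`, `chiβOfRecord₁₃Ax θ := chiFixed29Ax F N θ.ν θ.ε₂₉`).  The re-centred cut-off reads `θ.ν, θ.ε₂₉` only and the window `θ.γ` enters `betaOfRecord₈Tχ`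
ONLY through the box convention `betaOfMerged … θ.γ`, exactly as for `betaOfRecord₁₃` — so the three window letters and the rows transfer hold for the Ax β with the SAME proofs.  These are the
first Ax twins of the op-5b census (`N24-G22-OP5B-CENSUS.md` §B: `betaLowerH∕UpperH_theta13OfThm1CCMWZB_of_half`, `runRows_theta13OfThm1CCMWZB_window_of_half`).

HONEST FRAMING.  Kernel bookkeeping identities (`rfl`-level window transfer) and their transport through ✓p782215's generic §1; NO estimate of Bałaban's; nothing about the SIGN or SIZE
of any β is asserted; K1ᴬ DECIDING∕OPEN, K0ᴬ∕K3ᴬ OPEN; no node discharged; count-neutral; finite 𝕋⁴ at fixed ε — NOT continuum ∕ OS ∕ Clay; the Yang–Mills mass gap is NOT proved.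
Sources (context only): [I] = [Balaban1987RG1] CMP **109** (1987) (1.20)–(1.22) p.264, Thm 3 p.264, (5.10) p.293, §1 pp.263–264; [14] = [Balaban1988RG2Cluster] CMP **116** (1988) (2.9).
-/

noncomputable section

open scoped BigOperators

namespace Summit.QuantumFields.YangMills.Theorems.K1RunRowsBoxCongrAx

open Literature.MathematicalPhysics.QuantumFieldTheory.Balaban1983to89
open Literature.MathematicalPhysics.QuantumFieldTheory.Balaban1983to89.FlowStep
open Literature.MathematicalPhysics.QuantumFieldTheory.Balaban1983to89.Node00
open Literature.MathematicalPhysics.QuantumFieldTheory.Balaban1983to89.T4Continuum (T4Family)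
open Summit.QuantumFields.YangMills.Theorems.BalabanUVNodesK2NamedJetsRunRemAt (RunConstRemainder SurvCont Survivors)
open Summit.QuantumFields.YangMills.Theorems.K1RunRowsBoxCongr (runRows_of_eqOn_box)

/-! ## §1. The window transfer of the RE-CENTRED β at NODE 00's Z3 family (general `N`) -/

section Letters

variable {F : T4Family} {N : ℕ} [NeZero N] {j : ℕ} {γ εbg ε₀ ε₂₉ B₃ B₃' a₀ a₁ : ℝ} {Efl logz : B12.RunParams → ℕ → ℝ}

/-- **THE RE-CENTRED β OF THE WINDOW-`γ` Z3 MEMBER AGREES WITH THE HALF-WINDOW MEMBER's ON `]0, γ]^(k+1)`** (`γ ≤ ½`) — Ax twin of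
`Node00.betaOfRecord₁₃_theta13OfThm1CCMWZB_eq_of_mem`: both members carry the same numerics, (2.9)-threshold, background radius, chart, basis and base histories, the re-centred cut-off
`chiβOfRecord₁₃Ax` reads `θ.ν, θ.ε₂₉` only, and both box conventions read the one merged β on `]0, γ] ⊆ ]0, ½]` (`betaOfMerged_of_mem`). [cite: Balaban1987RG1, (1.20)–(1.22) p.264, (1.6) p.261, (2.12)–(2.14) p.268; Balaban1988RG2Cluster, (2.9) p.12 (bookkeeping)] -/
theorem betaOfRecord₁₃Ax_theta13OfThm1CCMWZB_eq_of_mem (hγ : γ ≤ 1 / 2) {k : ℕ} {v : Fin (k + 1) → ℝ} (hv : v ∈ Box γ k) :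
    betaOfRecord₁₃Ax F N (theta13OfThm1CCMWZB F N j γ εbg ε₀ ε₂₉ B₃ B₃' a₀ a₁ Efl logz) k v =
      betaOfRecord₁₃Ax F N (theta13OfThm1CCMWZB F N j (1 / 2) εbg ε₀ ε₂₉ B₃ B₃' a₀ a₁ Efl logz) k v := by
  have hv' : v ∈ Box (1 / 2 : ℝ) k := box_mono hγ k hv
  show betaOfMerged _ _ γ k v = betaOfMerged _ _ (1 / 2 : ℝ) k v
  rw [betaOfMerged_of_mem _ _ _ hv, betaOfMerged_of_mem _ _ _ hv']
  rfl

/-- **A LOWER β-BOUND OF THE HALF-WINDOW MEMBER's RE-CENTRED β ON `]0, γ]` IS ONE OF THE WINDOW EDITION** (`γ ≤ ½`) — Ax twin of `Node00.betaLowerH_theta13OfThm1CCMWZB_of_half`. [cite: Balaban1987RG1, (1.20)–(1.22) p.264, §1 p.264 (bookkeeping)] -/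
theorem betaLowerH_theta13OfThm1CCMWZB_of_half_Ax (hγ : γ ≤ 1 / 2) {b : ℝ}
    (h : BetaLowerH b γ (betaOfRecord₁₃Ax F N (theta13OfThm1CCMWZB F N j (1 / 2) εbg ε₀ ε₂₉ B₃ B₃' a₀ a₁ Efl logz))) :
    BetaLowerH b γ (betaOfRecord₁₃Ax F N (theta13OfThm1CCMWZB F N j γ εbg ε₀ ε₂₉ B₃ B₃' a₀ a₁ Efl logz)) :=
  fun k v hv => by rw [betaOfRecord₁₃Ax_theta13OfThm1CCMWZB_eq_of_mem hγ hv]; exact h k v hv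

/-- **AN UPPER β-BOUND OF THE HALF-WINDOW MEMBER's RE-CENTRED β ON `]0, γ]` IS ONE OF THE WINDOW EDITION** (`γ ≤ ½`) — Ax twin of `Node00.betaUpperH_theta13OfThm1CCMWZB_of_half`. [cite: Balaban1987RG1, (1.20)–(1.22) p.264, §1 p.264 («uniformly bounded») (bookkeeping)] -/
theorem betaUpperH_theta13OfThm1CCMWZB_of_half_Ax (hγ : γ ≤ 1 / 2) {β' : ℝ}
    (h : BetaUpperH β' γ (betaOfRecord₁₃Ax F N (theta13OfThm1CCMWZB F N j (1 / 2) εbg ε₀ ε₂₉ B₃ B₃' a₀ a₁ Efl logz))) :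
    BetaUpperH β' γ (betaOfRecord₁₃Ax F N (theta13OfThm1CCMWZB F N j γ εbg ε₀ ε₂₉ B₃ B₃' a₀ a₁ Efl logz)) :=
  fun k v hv => by rw [betaOfRecord₁₃Ax_theta13OfThm1CCMWZB_eq_of_mem hγ hv]; exact h k v hv

/-- **THE RE-CENTRED β OF THE Z3 MEMBER IS BLIND TO THE LETTERS `j, ε₀, B₃, B₃', a₁, Efl, logz`** (`rfl`) — Ax twin of k0's `K0V23Stub3Sockets.betaOfRecord₁₃_zbRegime_letterBlind`:
the re-centred β reads the numerics `ν` (hence `a₀` through `εbg := a₀`), the (2.9) threshold `ε₂₉`, the radius and the chart data only. [cite: Balaban1987RG1, (1.20)–(1.22) p.264 (bookkeeping)] -/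
theorem betaOfRecord₁₃Ax_zbRegime_letterBlind {j' : ℕ} {ε₀' C₃ C₃' c₁ : ℝ} {Efl' logz' : B12.RunParams → ℕ → ℝ} :
    betaOfRecord₁₃Ax F N (theta13OfThm1CCMWZB F N j γ εbg ε₀ ε₂₉ B₃ B₃' a₀ a₁ Efl logz) =
      betaOfRecord₁₃Ax F N (theta13OfThm1CCMWZB F N j' γ εbg ε₀' ε₂₉ C₃ C₃' a₀ c₁ Efl' logz') := rfl

end Letters

/-! ## §2. ★★ NODE O's FOUR RUN ROWS (Ax currency) AT THE DOORS' HALF-WINDOW Z3 MEMBER ⟶ THE ENGINE's WINDOW-EDITION MEMBER (`N = 2`) -/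

section Z3

variable {F : T4Family} {j j' : ℕ} {γ a₀ ε₀ ε₀' ε₂₉ B₃ B₃' C₃ C₃' a₁ c₁ : ℝ} {Efl logz Efl' logz' : B12.RunParams → ℕ → ℝ}

/-- **★★ THE Ax TWIN OF `K1RunRowsBoxCongr.runRows_theta13OfThm1CCMWZB_window_of_half`**: NODE O's four run rows of the RE-CENTRED β at the doors' half-window Z3 member
(`0 < γ ≤ ½`, same radius `a₀`, same threshold `ε₂₉`, every other letter free on both sides) give the rows at the engine's window-edition member — the two β's agree on `]0, γ]^(k+1)`
(§1's window transfer composed with the letter census), then ✓p782215's generic `runRows_of_eqOn_box`.  Spelled in K1ᴬ's inline currency (`RunConstRemainder` ∕ `SurvCont` unfold to it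
by `Iff.rfl`).  CONDITIONAL transport of displayed rows; nothing of NODE O's produced here. [cite: Balaban1987RG1, Thm 3 p.264, (5.10) p.293, §1 pp.263–264; Balaban1988RG2Cluster, (2.9) p.12 (bookkeeping)] -/
theorem runRows_theta13OfThm1CCMWZB_window_of_half_Ax (hγ0 : 0 < γ) (hγ : γ ≤ 1 / 2)
    (H : ∃ (b : ℕ → ℝ) (r γ₀ M : ℝ), 0 < γ₀ ∧
        (∀ (n : ℕ) (gs : ℕ → ℝ), RGEqH n (betaOfRecord₁₃Ax F 2 (theta13OfThm1CCMWZB F 2 j' (1 / 2) a₀ ε₀' ε₂₉ C₃ C₃' a₀ c₁ Efl' logz')) gs → Step.InInterval γ₀ n gs →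
          ∀ k, k ≤ n → |betaOfRecord₁₃Ax F 2 (theta13OfThm1CCMWZB F 2 j' (1 / 2) a₀ ε₀' ε₂₉ C₃ C₃' a₀ c₁ Efl' logz') k (prefixOf gs k) - b k| ≤ r) ∧
        (∀ (n : ℕ) (gs : ℕ → ℝ), RGEqH n (betaOfRecord₁₃Ax F 2 (theta13OfThm1CCMWZB F 2 j' (1 / 2) a₀ ε₀' ε₂₉ C₃ C₃' a₀ c₁ Efl' logz')) gs → Step.InInterval γ₀ n gs →
          ∀ k, k ≤ n → -M ≤ ∑ i ∈ Finset.Ico k n, betaOfRecord₁₃Ax F 2 (theta13OfThm1CCMWZB F 2 j' (1 / 2) a₀ ε₀' ε₂₉ C₃ C₃' a₀ c₁ Efl' logz') i (prefixOf gs i)) ∧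
        ∀ k : ℕ, ContinuousOn (fun x : ℝ => betaOfRecord₁₃Ax F 2 (theta13OfThm1CCMWZB F 2 j' (1 / 2) a₀ ε₀' ε₂₉ C₃ C₃' a₀ c₁ Efl' logz') k
            (clampPrefix (betaOfRecord₁₃Ax F 2 (theta13OfThm1CCMWZB F 2 j' (1 / 2) a₀ ε₀' ε₂₉ C₃ C₃' a₀ c₁ Efl' logz')) γ₀ k x))
          {x : ℝ | 0 < x ∧ x ≤ γ₀ ∧ ∀ i, i ≤ k → 1 / γ₀ ^ 2 ≤ Y (betaOfRecord₁₃Ax F 2 (theta13OfThm1CCMWZB F 2 j' (1 / 2) a₀ ε₀' ε₂₉ C₃ C₃' a₀ c₁ Efl' logz')) γ₀ i x}) :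
    ∃ (b : ℕ → ℝ) (r γ₀ M : ℝ), 0 < γ₀ ∧
        (∀ (n : ℕ) (gs : ℕ → ℝ), RGEqH n (betaOfRecord₁₃Ax F 2 (theta13OfThm1CCMWZB F 2 j γ a₀ ε₀ ε₂₉ B₃ B₃' a₀ a₁ Efl logz)) gs → Step.InInterval γ₀ n gs →
          ∀ k, k ≤ n → |betaOfRecord₁₃Ax F 2 (theta13OfThm1CCMWZB F 2 j γ a₀ ε₀ ε₂₉ B₃ B₃' a₀ a₁ Efl logz) k (prefixOf gs k) - b k| ≤ r) ∧
        (∀ (n : ℕ) (gs : ℕ → ℝ), RGEqH n (betaOfRecord₁₃Ax F 2 (theta13OfThm1CCMWZB F 2 j γ a₀ ε₀ ε₂₉ B₃ B₃' a₀ a₁ Efl logz)) gs → Step.InInterval γ₀ n gs →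
          ∀ k, k ≤ n → -M ≤ ∑ i ∈ Finset.Ico k n, betaOfRecord₁₃Ax F 2 (theta13OfThm1CCMWZB F 2 j γ a₀ ε₀ ε₂₉ B₃ B₃' a₀ a₁ Efl logz) i (prefixOf gs i)) ∧
        ∀ k : ℕ, ContinuousOn (fun x : ℝ => betaOfRecord₁₃Ax F 2 (theta13OfThm1CCMWZB F 2 j γ a₀ ε₀ ε₂₉ B₃ B₃' a₀ a₁ Efl logz) k
            (clampPrefix (betaOfRecord₁₃Ax F 2 (theta13OfThm1CCMWZB F 2 j γ a₀ ε₀ ε₂₉ B₃ B₃' a₀ a₁ Efl logz)) γ₀ k x))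
          {x : ℝ | 0 < x ∧ x ≤ γ₀ ∧ ∀ i, i ≤ k → 1 / γ₀ ^ 2 ≤ Y (betaOfRecord₁₃Ax F 2 (theta13OfThm1CCMWZB F 2 j γ a₀ ε₀ ε₂₉ B₃ B₃' a₀ a₁ Efl logz)) γ₀ i x} :=
  runRows_of_eqOn_box (β₂ := betaOfRecord₁₃Ax F 2 (theta13OfThm1CCMWZB F 2 j' (1 / 2) a₀ ε₀' ε₂₉ C₃ C₃' a₀ c₁ Efl' logz')) hγ0
    (fun k v hv => by
      rw [betaOfRecord₁₃Ax_theta13OfThm1CCMWZB_eq_of_mem hγ hv]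
      exact congrFun (congrFun (betaOfRecord₁₃Ax_zbRegime_letterBlind (F := F) (N := 2) (γ := 1 / 2) (εbg := a₀)) k) v)
    H

end Z3

end Summit.QuantumFields.YangMills.Theorems.K1RunRowsBoxCongrAx

end
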